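import Mathlib
import HarnessLib

/-!
# Far-edge descent, kernel XLII-A (2/3) — pinning `|d| ≤ V²` is closed under products (model level)

Kernel XL-A (`FarEdgeDescentWidthTransform`) reduced the width cascade of the β-dial to two scalars
per node, the SHARE `λ = L/(Q+βL)` and the NARROWNESS `V(z) = p(z)/(z·L) ∈ [0,1]`, with the exact
product rules `λ_P = λ + λ' − (2β−1)λλ'` and
`V_P·λ_P = λ'(1−βλ)·V' + λ(1−βλ')·V + z·λλ'·V·V'`.  Kernel XLI (`FarEdgeDescentFloorDial`,
`FarEdgeDescentTreeCap`) typed the cap conjecture XL-D over all binary schedules `Sched` and proved it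
along chains and caterpillars; memo g61 §3 recorded why the tree case resisted: every potential in
`V` alone fails at LIGHT bases, and the pair criterion is false on the full box `λ ≤ 1/β, V ≤ 1`.

Kernel XLII-A (three files: `…FixedPointWedge`, `…FixedPointPinning`, `…PinnedSchedules`) isolates
the structural law that removes the bad corner of the box.  Write `d := 1 − (2β−1)·λ` (so `d = 0`
is the fixed point `λ* = 1/(2β−1)` of the share map, `d < 0` the LIGHT side, `d > 0` the HEAVY side,
and `β−1+β·d ≥ 0 ⟺ λ ≤ 1/β`).  Then `d` is MULTIPLICATIVE (`d_P = d·d'`), and two inequalities are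
closed under products and hold at every base:
* WEDGE (W): `β·(−d) ≤ (β−1)·V` — a light node is narrow in proportion to its lightness;
* PINNING (Q): `|d| ≤ V²` — a node whose legs have spread (`V` small) is pinned to the fixed point,
  quadratically, and a very heavy node is narrow.

THIS FILE: the closure of (Q).  Writing `|d| = a²`, `|d'| = b²`, (Q) for the factors is `a ≤ V`,
`b ≤ V'` and for the product `ab ≤ V_P`; the right-hand side of the product rule is monotone in
`(V, V')` (`rhs_mono`), so each sign case reduces to a polynomial inequality in `(a, b)` with an
explicit certificate: `pin_closure_pp` (heavy × heavy, `(1−a)(1−b)·Q₊₊ ≥ 0`, needs `3/2 ≤ β`),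
`pin_closure_mp` (light × heavy, `(1−b)·Q₋₊ ≥ 0`, needs `9/10 ≤ z`), `pin_closure_mm` (light × light,
through the wedges and `ab ≤ (a²+b²)/2`, needs `β ≤ 2`); `pin_closure` assembles the sign cases in
`d`-coordinates: for `3/2 ≤ β ≤ 2`, `9/10 ≤ z`, ranges + (W) + (Q) for both factors ⟹ (Q) for the
product.  (The parameter window is where the certificates are checked, not a claimed threshold.)

HONEST FRAMING: MODEL level (real numbers; the dictionary node ↦ `(Q, p)` is kernels XXXIX-K/XL-A);
no `sorry`, no new axioms.  Nothing here touches `_root_.MatrixMultiplication` or the `closes` cut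
of the route.  References: Schönhage 1981 [Schonhage1981]; Coppersmith–Winograd
[CoppersmithWinograd1990]; kernels XL-A, XLI-A/B; memo g62 (decomp-mm-lens-2).
-/

noncomputable section

set_option linter.dupNamespace false

namespace Summit.MatrixMultiplication.MatrixMultiplication.Theorems.FarEdgeDescentFixedPointPinning

/-! ## 1. Pinning closure (Q): `|d| ≤ V²` is preserved

We write `|d| = a²`, `|d'| = b²` with `a, b ≥ 0`; (Q) for the factors reads `a ≤ V`, `b ≤ V'`
(given `V, V' ≥ 0`), and (Q) for the product is `a·b ≤ V_P`.  The right-hand side of the product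
rule is monotone in `V, V'` (its coefficients are nonnegative), so it suffices to check the
inequality at the smallest admissible `V, V'`; what remains is a polynomial inequality in `(a, b)`
with the parameters `β, z`. -/

/-- Monotonicity of the right-hand side of the product rule in `(V, V')`. -/
theorem rhs_mono {c₁ c₂ c₃ a b V V' : ℝ} (h₁ : 0 ≤ c₁) (h₂ : 0 ≤ c₂) (h₃ : 0 ≤ c₃)
    (ha : 0 ≤ a) (hb : 0 ≤ b) (hVa : a ≤ V) (hVb : b ≤ V') :
    c₁ * b + c₂ * a + c₃ * a * b ≤ c₁ * V' + c₂ * V + c₃ * V * V' := by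
  have hab : a * b ≤ V * V' := mul_le_mul hVa hVb hb (le_trans ha hVa)
  have e1 := mul_le_mul_of_nonneg_left hVb h₁
  have e2 := mul_le_mul_of_nonneg_left hVa h₂
  have e3 := mul_le_mul_of_nonneg_left hab h₃
  nlinarith [e1, e2, e3]

/-- **(Q), heavy × heavy.**  `d = a²`, `d' = b²`:  `a ≤ V`, `b ≤ V'` ⟹ `ab ≤ V_P`
(`3/2 ≤ β`, `0 ≤ z`).  Certificate: `RHS(a,b) − (2β−1)(1−a²b²)ab = (1−a)(1−b)·Q₊₊` with
`Q₊₊ = (β−1)(a+b) + (β−1)(a²+b²) + (z−1)ab + (β+z−1)(a²b+ab²) + (2β+z−1)a²b² ≥ 0`. -/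
theorem pin_closure_pp {β z a b V V' VP : ℝ} (hβ : 3 / 2 ≤ β) (hz : 0 ≤ z)
    (ha : 0 ≤ a) (ha1 : a < 1) (hb : 0 ≤ b) (hb1 : b < 1)
    (hV : a ≤ V) (hV' : b ≤ V')
    (hP : VP * ((2 * β - 1) * (1 - a ^ 2 * b ^ 2)) =
      (1 - b ^ 2) * (β - 1 + β * a ^ 2) * V' + (1 - a ^ 2) * (β - 1 + β * b ^ 2) * V +
        z * (1 - a ^ 2) * (1 - b ^ 2) * V * V') :
    a * b ≤ VP := by
  have ha2 : a ^ 2 < 1 := by nlinarith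
  have hb2 : b ^ 2 < 1 := by nlinarith
  have hX : 0 < (2 * β - 1) * (1 - a ^ 2 * b ^ 2) := by
    apply mul_pos (by linarith); nlinarith [mul_nonneg (sq_nonneg a) (sq_nonneg b)]
  have hc1 : 0 ≤ (1 - b ^ 2) * (β - 1 + β * a ^ 2) := by
    apply mul_nonneg (by linarith); nlinarith [sq_nonneg a]
  have hc2 : 0 ≤ (1 - a ^ 2) * (β - 1 + β * b ^ 2) := by
    apply mul_nonneg (by linarith); nlinarith [sq_nonneg b]
  have hc3 : 0 ≤ z * (1 - a ^ 2) * (1 - b ^ 2) := by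
    apply mul_nonneg (mul_nonneg hz (by linarith)) (by linarith)
  have hm := rhs_mono hc1 hc2 hc3 ha hb hV hV'
  have hid : (1 - b ^ 2) * (β - 1 + β * a ^ 2) * b + (1 - a ^ 2) * (β - 1 + β * b ^ 2) * a +
      z * (1 - a ^ 2) * (1 - b ^ 2) * a * b - (2 * β - 1) * (1 - a ^ 2 * b ^ 2) * (a * b) =
      (1 - a) * (1 - b) * ((β - 1) * (a + b) + (β - 1) * (a ^ 2 + b ^ 2) + (z - 1) * (a * b) +
        (β + z - 1) * (a ^ 2 * b + a * b ^ 2) + (2 * β + z - 1) * (a ^ 2 * b ^ 2)) := by ring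
  have hQ : 0 ≤ (β - 1) * (a + b) + (β - 1) * (a ^ 2 + b ^ 2) + (z - 1) * (a * b) +
      (β + z - 1) * (a ^ 2 * b + a * b ^ 2) + (2 * β + z - 1) * (a ^ 2 * b ^ 2) := by
    have hab : 0 ≤ a * b := mul_nonneg ha hb
    have h1 : 0 ≤ (β - 1) * (a + b) := by apply mul_nonneg (by linarith); linarith
    have h2 : 0 ≤ (β - 1) * (a ^ 2 + b ^ 2) + (z - 1) * (a * b) := by
      nlinarith [sq_nonneg (a - b), mul_nonneg hz hab]
    have h3 : 0 ≤ (β + z - 1) * (a ^ 2 * b + a * b ^ 2) := by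
      apply mul_nonneg (by linarith); nlinarith [mul_nonneg hab ha, mul_nonneg hab hb]
    have h4 : 0 ≤ (2 * β + z - 1) * (a ^ 2 * b ^ 2) := by
      apply mul_nonneg (by linarith); positivity
    linarith
  have hP0 : 0 ≤ (1 - a) * (1 - b) * ((β - 1) * (a + b) + (β - 1) * (a ^ 2 + b ^ 2) +
      (z - 1) * (a * b) + (β + z - 1) * (a ^ 2 * b + a * b ^ 2) +
      (2 * β + z - 1) * (a ^ 2 * b ^ 2)) :=
    mul_nonneg (mul_nonneg (by linarith) (by linarith)) hQ
  have hfin : (a * b) * ((2 * β - 1) * (1 - a ^ 2 * b ^ 2)) ≤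
      VP * ((2 * β - 1) * (1 - a ^ 2 * b ^ 2)) := by
    rw [hP]; nlinarith [hm, hid, hP0]
  exact le_of_mul_le_mul_right hfin hX

set_option maxHeartbeats 400000 in
/-- **(Q), light × heavy.**  `d = −a²` (with the wedge `βa² ≤ (β−1)V`), `d' = b²`:
`a ≤ V`, `b ≤ V'` ⟹ `ab ≤ V_P` (`3/2 ≤ β`, `9/10 ≤ z`).  Certificate:
`RHS(a,b) − (2β−1)(1+a²b²)ab = (1−b)·Q₋₊`, `Q₋₊ = (b+b²)(β−1−βa²) + a·h`,
`h = (β−1) − (β−z)b + zb² + a²((β−1) + (β+z−1)b + (2β+z−1)b²) ≥ 0`. -/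
theorem pin_closure_mp {β z a b V V' VP : ℝ} (hβ : 3 / 2 ≤ β) (hz : 9 / 10 ≤ z)
    (ha : 0 ≤ a) (haw : 0 ≤ β - 1 - β * a ^ 2) (hb : 0 ≤ b) (hb1 : b < 1)
    (hV : a ≤ V) (hV' : b ≤ V')
    (hP : VP * ((2 * β - 1) * (1 + a ^ 2 * b ^ 2)) =
      (1 - b ^ 2) * (β - 1 - β * a ^ 2) * V' + (1 + a ^ 2) * (β - 1 + β * b ^ 2) * V +
        z * (1 + a ^ 2) * (1 - b ^ 2) * V * V') :
    a * b ≤ VP := by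
  have hb2 : b ^ 2 < 1 := by nlinarith
  have hX : 0 < (2 * β - 1) * (1 + a ^ 2 * b ^ 2) := by
    apply mul_pos (by linarith); positivity
  have hc1 : 0 ≤ (1 - b ^ 2) * (β - 1 - β * a ^ 2) := mul_nonneg (by linarith) haw
  have hc2 : 0 ≤ (1 + a ^ 2) * (β - 1 + β * b ^ 2) := by
    apply mul_nonneg (by positivity); nlinarith [sq_nonneg b]
  have hc3 : 0 ≤ z * (1 + a ^ 2) * (1 - b ^ 2) := by
    apply mul_nonneg (mul_nonneg (by linarith) (by positivity)) (by linarith)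
  have hm := rhs_mono hc1 hc2 hc3 ha hb hV hV'
  have hid : (1 - b ^ 2) * (β - 1 - β * a ^ 2) * b + (1 + a ^ 2) * (β - 1 + β * b ^ 2) * a +
      z * (1 + a ^ 2) * (1 - b ^ 2) * a * b - (2 * β - 1) * (1 + a ^ 2 * b ^ 2) * (a * b) =
      (1 - b) * ((b + b ^ 2) * (β - 1 - β * a ^ 2) + a * ((β - 1) - (β - z) * b + z * b ^ 2 +
        a ^ 2 * ((β - 1) + (β + z - 1) * b + (2 * β + z - 1) * b ^ 2))) := by ring
  have hh : 0 ≤ (β - 1) - (β - z) * b + z * b ^ 2 +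
      a ^ 2 * ((β - 1) + (β + z - 1) * b + (2 * β + z - 1) * b ^ 2) := by
    -- (β-1) - (β-z) b + z b² = (β-1)(1-b)² + b((β-2+z) + (z-β+1) b), both pieces ≥ 0 on b ∈ [0,1]
    have e : (β - 1) - (β - z) * b + z * b ^ 2 =
        (β - 1) * (1 - b) ^ 2 + b * ((β - 2 + z) + (z - β + 1) * b) := by ring
    have h1 : 0 ≤ (β - 1) * (1 - b) ^ 2 := mul_nonneg (by linarith) (sq_nonneg _)
    have h2 : 0 ≤ (β - 2 + z) + (z - β + 1) * b := by
      -- linear in b; value at b=0 is β-2+z ≥ 0, at b=1 is 2z-1 ≥ 0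
      nlinarith [mul_nonneg hb (by linarith : (0:ℝ) ≤ 2 * z - 1),
        mul_nonneg (by linarith : (0:ℝ) ≤ 1 - b) (by linarith : (0:ℝ) ≤ β - 2 + z)]
    have h3 : 0 ≤ b * ((β - 2 + z) + (z - β + 1) * b) := mul_nonneg hb h2
    have h4 : 0 ≤ a ^ 2 * ((β - 1) + (β + z - 1) * b + (2 * β + z - 1) * b ^ 2) := by
      apply mul_nonneg (sq_nonneg a)
      nlinarith [mul_nonneg hb (by linarith : (0:ℝ) ≤ β + z - 1), sq_nonneg b]
    linarith
  have hQ : 0 ≤ (b + b ^ 2) * (β - 1 - β * a ^ 2) + a * ((β - 1) - (β - z) * b + z * b ^ 2 +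
      a ^ 2 * ((β - 1) + (β + z - 1) * b + (2 * β + z - 1) * b ^ 2)) := by
    have : 0 ≤ (b + b ^ 2) * (β - 1 - β * a ^ 2) := mul_nonneg (by positivity) haw
    have := mul_nonneg ha hh
    linarith
  have hP0 := mul_nonneg (by linarith : (0:ℝ) ≤ 1 - b) hQ
  have hfin : (a * b) * ((2 * β - 1) * (1 + a ^ 2 * b ^ 2)) ≤
      VP * ((2 * β - 1) * (1 + a ^ 2 * b ^ 2)) := by
    rw [hP]; nlinarith [hm, hid, hP0]
  exact le_of_mul_le_mul_right hfin hX

set_option maxHeartbeats 400000 in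
/-- **(Q), light × light.**  `d = −a²`, `d' = −b²` with the wedges `βa² ≤ (β−1)V`,
`βb² ≤ (β−1)V'`:  `ab ≤ V_P` (`3/2 ≤ β ≤ 2`, `9/10 ≤ z`).  Here the wedge lower bounds are used
(`(β−1)V ≥ βa²`), then `ab ≤ (a²+b²)/2`, leaving (with `s = a²`, `t = b² ≤ (β−1)/β`)
`G = (β−1)²(s+t)/2 + β(β−1)²(s−t)² + st(zβ² − 2β(β−1)) + (s²t+st²)(zβ² − (3β−1)(β−1)/2)
+ zβ²s²t² ≥ 0`, where the first term dominates the third because `s, t ≤ (β−1)/β`. -/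
theorem pin_closure_mm {β z a b V V' VP : ℝ} (hβ : 3 / 2 ≤ β) (hβ2 : β ≤ 2)
    (hz : 9 / 10 ≤ z)
    (ha : 0 ≤ a) (haw : 0 ≤ β - 1 - β * a ^ 2) (hb : 0 ≤ b) (hbw : 0 ≤ β - 1 - β * b ^ 2)
    (hW : β * a ^ 2 ≤ (β - 1) * V) (hW' : β * b ^ 2 ≤ (β - 1) * V')
    (hP : VP * ((2 * β - 1) * (1 - a ^ 2 * b ^ 2)) =
      (1 + b ^ 2) * (β - 1 - β * a ^ 2) * V' + (1 + a ^ 2) * (β - 1 - β * b ^ 2) * V +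
        z * (1 + a ^ 2) * (1 + b ^ 2) * V * V') :
    a * b ≤ VP := by
  set s := a ^ 2 with hs
  set t := b ^ 2 with ht
  have hs0 : 0 ≤ s := sq_nonneg a
  have ht0 : 0 ≤ t := sq_nonneg b
  have hs1 : β * s ≤ β - 1 := by linarith
  have ht1 : β * t ≤ β - 1 := by linarith
  have hβ0 : 0 < β := by linarith
  have hslt : s < 1 := by
    by_contra h
    push Not at h
    have := mul_le_mul_of_nonneg_left h hβ0.le
    linarith
  have htlt : t < 1 := by
    by_contra h
    push Not at h
    have := mul_le_mul_of_nonneg_left h hβ0.le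
    linarith
  have hst1 : 0 < 1 - s * t := by
    have : s * t ≤ s * 1 := mul_le_mul_of_nonneg_left htlt.le hs0
    linarith
  have hX : 0 < (2 * β - 1) * (1 - s * t) := mul_pos (by linarith) hst1
  have hβ1 : 0 < β - 1 := by linarith
  -- Step 1: (β-1)²·RHS(V,V') ≥ LHS(s,t) using X := (β-1)V ≥ βs, Y := (β-1)V' ≥ βt.
  have hc1 : 0 ≤ (1 + t) * (β - 1 - β * s) := mul_nonneg (by linarith) haw
  have hc2 : 0 ≤ (1 + s) * (β - 1 - β * t) := mul_nonneg (by linarith) hbw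
  have hc3 : 0 ≤ z * (1 + s) * (1 + t) := by
    apply mul_nonneg (mul_nonneg (by linarith) (by linarith)) (by linarith)
  have hm : (1 + t) * (β - 1 - β * s) * (β - 1) * (β * t) +
      (1 + s) * (β - 1 - β * t) * (β - 1) * (β * s) + z * (1 + s) * (1 + t) * (β * s) * (β * t) ≤
      (1 + t) * (β - 1 - β * s) * (β - 1) * ((β - 1) * V') +
      (1 + s) * (β - 1 - β * t) * (β - 1) * ((β - 1) * V) +
      z * (1 + s) * (1 + t) * ((β - 1) * V) * ((β - 1) * V') := by
    have hm0 := rhs_mono (mul_nonneg hc1 hβ1.le) (mul_nonneg hc2 hβ1.le) hc3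
      (by positivity : (0:ℝ) ≤ β * s) (by positivity : (0:ℝ) ≤ β * t) hW hW'
    nlinarith [hm0]
  -- Step 2: LHS(s,t) ≥ (β-1)²(2β-1)(1-st)·ab, via ab ≤ (s+t)/2 and the certificate G ≥ 0.
  have hab : a * b ≤ (s + t) / 2 := by nlinarith [sq_nonneg (a - b)]
  have hab0 : 0 ≤ a * b := mul_nonneg ha hb
  have hG : (β - 1) ^ 2 * (2 * β - 1) * (1 - s * t) * ((s + t) / 2) ≤
      (1 + t) * (β - 1 - β * s) * (β - 1) * (β * t) +
      (1 + s) * (β - 1 - β * t) * (β - 1) * (β * s) + z * (1 + s) * (1 + t) * (β * s) * (β * t) := by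
    have hid : (1 + t) * (β - 1 - β * s) * (β - 1) * (β * t) +
        (1 + s) * (β - 1 - β * t) * (β - 1) * (β * s) + z * (1 + s) * (1 + t) * (β * s) * (β * t) -
        (β - 1) ^ 2 * (2 * β - 1) * (1 - s * t) * ((s + t) / 2) =
        (β - 1) ^ 2 / 2 * (s + t) + β * (β - 1) ^ 2 * (s - t) ^ 2 +
        s * t * (z * β ^ 2 - 2 * β * (β - 1)) +
        (s ^ 2 * t + s * t ^ 2) * (z * β ^ 2 - (3 * β - 1) * (β - 1) / 2) +
        z * β ^ 2 * (s ^ 2 * t ^ 2) := by ring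
    -- the linear term dominates the (possibly negative) st term: (β-1)(s+t)/2 ≥ β st
    have hdom : β * (s * t) ≤ (β - 1) * (s + t) / 2 := by
      have e1 := mul_nonneg hs0 hbw
      have e2 := mul_nonneg ht0 haw
      linarith [e1, e2]
    have hst0 : 0 ≤ s * t := mul_nonneg hs0 ht0
    have hzb2 : 9 / 10 * β ^ 2 ≤ z * β ^ 2 := mul_le_mul_of_nonneg_right hz (sq_nonneg β)
    have hzb : 9 / 10 * β ≤ z * β := mul_le_mul_of_nonneg_right hz (by linarith)
    have hrange := mul_nonneg (sub_nonneg.mpr hβ) (sub_nonneg.mpr hβ2)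
    have hcub : 0 ≤ z * β ^ 2 - (3 * β - 1) * (β - 1) / 2 := by nlinarith [hzb2, hrange]
    have hq : 0 ≤ z * β - (β - 1) := by linarith [hzb]
    have h1 : 0 ≤ (β - 1) ^ 2 / 2 * (s + t) + s * t * (z * β ^ 2 - 2 * β * (β - 1)) := by
      -- (β-1)²(s+t)/2 ≥ (β-1)β st, and (β-1)β + zβ² - 2β(β-1) = β(zβ - (β-1)) ≥ 0
      have e1 : (β - 1) * (β * (s * t)) ≤ (β - 1) * ((β - 1) * (s + t) / 2) :=
        mul_le_mul_of_nonneg_left hdom hβ1.le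
      have e2 : 0 ≤ s * t * (β * (z * β - (β - 1))) := mul_nonneg hst0 (by positivity)
      linarith [e1, e2]
    have h2 : 0 ≤ β * (β - 1) ^ 2 * (s - t) ^ 2 := by positivity
    have h3 : 0 ≤ (s ^ 2 * t + s * t ^ 2) * (z * β ^ 2 - (3 * β - 1) * (β - 1) / 2) :=
      mul_nonneg (by positivity) hcub
    have h4 : 0 ≤ z * β ^ 2 * (s ^ 2 * t ^ 2) := by
      apply mul_nonneg (mul_nonneg (by linarith) (sq_nonneg β)); positivity
    linarith
  have hG' : (β - 1) ^ 2 * (2 * β - 1) * (1 - s * t) * (a * b) ≤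
      (β - 1) ^ 2 * (2 * β - 1) * (1 - s * t) * ((s + t) / 2) := by
    apply mul_le_mul_of_nonneg_left hab
    have : 0 ≤ (β - 1) ^ 2 * (2 * β - 1) := mul_nonneg (sq_nonneg _) (by linarith)
    exact mul_nonneg this hst1.le
  -- Step 3: combine: (β-1)² · VP · X ≥ (β-1)² · ab · X, cancel.
  have hfin : ((β - 1) ^ 2 * (a * b)) * ((2 * β - 1) * (1 - s * t)) ≤
      ((β - 1) ^ 2 * VP) * ((2 * β - 1) * (1 - s * t)) := by
    have e : ((β - 1) ^ 2 * VP) * ((2 * β - 1) * (1 - s * t)) =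
        (1 + t) * (β - 1 - β * s) * (β - 1) * ((β - 1) * V') +
        (1 + s) * (β - 1 - β * t) * (β - 1) * ((β - 1) * V) +
        z * (1 + s) * (1 + t) * ((β - 1) * V) * ((β - 1) * V') := by
      have := hP
      linear_combination ((β - 1) ^ 2) * this
    rw [e]
    linarith [hm, hG, hG']
  have h5 : (β - 1) ^ 2 * (a * b) ≤ (β - 1) ^ 2 * VP := le_of_mul_le_mul_right hfin hX
  exact le_of_mul_le_mul_left h5 (by positivity)

/-! ## 2. Pinning closure in `d`-coordinates (all sign cases) -/

/-- `√|d| ≤ V` from `|d| ≤ V²`, `0 ≤ V`. -/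
theorem sqrt_abs_le {d V : ℝ} (hV : 0 ≤ V) (hQ : |d| ≤ V ^ 2) : Real.sqrt |d| ≤ V :=
  calc Real.sqrt |d| ≤ Real.sqrt (V ^ 2) := Real.sqrt_le_sqrt hQ
    _ = V := Real.sqrt_sq hV

/-- `√|d| < 1` on the admissible range `−1 < d < 1`. -/
theorem sqrt_abs_lt_one {β d : ℝ} (hβ : 1 < β) (hd : 0 ≤ β - 1 + β * d) (hd1 : d < 1) :
    Real.sqrt |d| < 1 := by
  have h1 : -1 < d := by nlinarith
  have habs : |d| < 1 := abs_lt.mpr ⟨h1, hd1⟩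
  have h0 : 0 ≤ Real.sqrt |d| := Real.sqrt_nonneg _
  have hsq : Real.sqrt |d| ^ 2 = |d| := Real.sq_sqrt (abs_nonneg d)
  by_contra h
  push Not at h
  nlinarith

set_option maxHeartbeats 400000 in
/-- **Pinning closure (Q).**  For `3/2 ≤ β ≤ 2` and `9/10 ≤ z`: if both factors satisfy the
range conditions, the wedge (W) and the pinning (Q) `|d| ≤ V²`, then the product satisfies (Q):
`|d·d'| ≤ V_P²`. -/
theorem pin_closure {β z d d' V V' VP : ℝ} (hβ : 3 / 2 ≤ β) (hβ2 : β ≤ 2) (hz : 9 / 10 ≤ z)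
    (hd : 0 ≤ β - 1 + β * d) (hd1 : d < 1) (hd' : 0 ≤ β - 1 + β * d') (hd1' : d' < 1)
    (hV : 0 ≤ V) (hV' : 0 ≤ V')
    (hW : β * (-d) ≤ (β - 1) * V) (hW' : β * (-d') ≤ (β - 1) * V')
    (hQ : |d| ≤ V ^ 2) (hQ' : |d'| ≤ V' ^ 2)
    (hP : VP * ((2 * β - 1) * (1 - d * d')) =
      (1 - d') * (β - 1 + β * d) * V' + (1 - d) * (β - 1 + β * d') * V +
        z * (1 - d) * (1 - d') * V * V') :
    |d * d'| ≤ VP ^ 2 := by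
  have hβ1 : 1 < β := by linarith
  set a := Real.sqrt |d| with ha_def
  set b := Real.sqrt |d'| with hb_def
  have ha : 0 ≤ a := Real.sqrt_nonneg _
  have hb : 0 ≤ b := Real.sqrt_nonneg _
  have ha2 : a ^ 2 = |d| := Real.sq_sqrt (abs_nonneg d)
  have hb2 : b ^ 2 = |d'| := Real.sq_sqrt (abs_nonneg d')
  have haV : a ≤ V := sqrt_abs_le hV hQ
  have hbV : b ≤ V' := sqrt_abs_le hV' hQ'
  have ha1 : a < 1 := sqrt_abs_lt_one hβ1 hd hd1
  have hb1 : b < 1 := sqrt_abs_lt_one hβ1 hd' hd1'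
  have habs : |d * d'| = (a * b) ^ 2 := by rw [abs_mul, mul_pow, ha2, hb2]
  rw [habs]
  -- it suffices to show a·b ≤ V_P
  suffices h : a * b ≤ VP by
    exact pow_le_pow_left₀ (mul_nonneg ha hb) h 2
  rcases le_total 0 d with hdp | hdn
  · have hda : d = a ^ 2 := by rw [ha2, abs_of_nonneg hdp]
    rcases le_total 0 d' with hd'p | hd'n
    · -- heavy × heavy
      have hdb : d' = b ^ 2 := by rw [hb2, abs_of_nonneg hd'p]
      rw [hda, hdb] at hP
      exact pin_closure_pp hβ (by linarith) ha ha1 hb hb1 haV hbV hP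
    · -- heavy × light: apply the light × heavy lemma with the factors swapped
      have hdb : d' = -b ^ 2 := by
        rw [hb2, abs_of_nonpos hd'n]; ring
      have hbw : 0 ≤ β - 1 - β * b ^ 2 := by rw [hdb] at hd'; linarith
      have hP' : VP * ((2 * β - 1) * (1 + b ^ 2 * a ^ 2)) =
          (1 - a ^ 2) * (β - 1 - β * b ^ 2) * V + (1 + b ^ 2) * (β - 1 + β * a ^ 2) * V' +
            z * (1 + b ^ 2) * (1 - a ^ 2) * V' * V := by
        rw [hda, hdb] at hP; linear_combination hP
      have := pin_closure_mp hβ hz hb hbw ha ha1 hbV haV hP'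
      linarith [mul_comm a b]
  · have hda : d = -a ^ 2 := by
      rw [ha2, abs_of_nonpos hdn]; ring
    have haw : 0 ≤ β - 1 - β * a ^ 2 := by rw [hda] at hd; linarith
    rcases le_total 0 d' with hd'p | hd'n
    · -- light × heavy
      have hdb : d' = b ^ 2 := by rw [hb2, abs_of_nonneg hd'p]
      have hP' : VP * ((2 * β - 1) * (1 + a ^ 2 * b ^ 2)) =
          (1 - b ^ 2) * (β - 1 - β * a ^ 2) * V' + (1 + a ^ 2) * (β - 1 + β * b ^ 2) * V +
            z * (1 + a ^ 2) * (1 - b ^ 2) * V * V' := by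
        rw [hda, hdb] at hP; linear_combination hP
      exact pin_closure_mp hβ hz ha haw hb hb1 haV hbV hP'
    · -- light × light
      have hdb : d' = -b ^ 2 := by
        rw [hb2, abs_of_nonpos hd'n]; ring
      have hbw : 0 ≤ β - 1 - β * b ^ 2 := by rw [hdb] at hd'; linarith
      have hWa : β * a ^ 2 ≤ (β - 1) * V := by rw [hda] at hW; linarith
      have hWb : β * b ^ 2 ≤ (β - 1) * V' := by rw [hdb] at hW'; linarith
      have hP' : VP * ((2 * β - 1) * (1 - a ^ 2 * b ^ 2)) =
          (1 + b ^ 2) * (β - 1 - β * a ^ 2) * V' + (1 + a ^ 2) * (β - 1 - β * b ^ 2) * V +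
            z * (1 + a ^ 2) * (1 + b ^ 2) * V * V' := by
        rw [hda, hdb] at hP; linear_combination hP
      exact pin_closure_mm hβ hβ2 hz ha haw hb hbw hWa hWb hP'

end Summit.MatrixMultiplication.MatrixMultiplication.Theorems.FarEdgeDescentFixedPointPinning
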